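import Mathlib
import HarnessLib
import Literature.Computability.AlgebraicComplexity.BD17DescartesSystemsWronskians
import Literature.Computability.AlgebraicComplexity.BD17RealExponentDescartesRule
import Literature.Computability.AlgebraicComplexity.BD17GaleRootCount
import Literature.Analysis.ODE.GrassmannConvexity
import Summits.ValiantsHypothesis.ValiantsHypothesis.Theorems.KPlusLogSqLawWeakLiftingTowerGraftWronskianConjectureWDefs

/-!
# Tower graft line — CONJECTURE W IS A COROLLARY OF THE GRASSMANN CONVEXITY THEOREM FOR `k = 2`
# (Saldanha–Shapiro–Shapiro 2021): `ConjectureW` from ONE cited named fact, for EVERY `K`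

Helper file for LINE (B) `Cruxes/WeakLifting/Lines/tower_graft.lean` (crux `WeakLifting` = stmt-ValiantsHypothesis-19561).
Hands g9–g12 of leafhand-val-kpluslogsqlaw-1 isolated CONJECTURE W («`Z₊(W(u,v)) ≤ 2K − 4` for two real `K`-nomials on a common
support», `…WronskianConjectureWDefs`, g11) as the located target (W-4) of the line and proved support families.  THIS FILE (hand
g13) records that Conjecture W — for every `K` — is a special case of a PUBLISHED THEOREM: the `k = 2` case of the Grassmann
convexity conjecture of B. and M. Shapiro, proved by N. Saldanha, B. Shapiro, M. Shapiro, *Grassmann convexity and multiplicative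
Sturm theory, revisited*, Mosc. Math. J. 21 (2021) 613–637 (arXiv:1902.09741), THEOREM 1: «Conjecture 1.2 holds for `k = 2` and
`k = n − 2` for any `n ≥ 3`», where Conjecture 1.2 reads «Given any equation `y⁽ⁿ⁾ + p₁(x)y⁽ⁿ⁻¹⁾ + … + pₙ(x)y = 0` disconjugate on
`I`, a positive integer `1 ≤ k ≤ n − 1`, and an arbitrary `k`-tuple `(y₁, …, y_k)` of its linearly independent solutions, the
number of real zeros of `det W(y₁, …, y_k)` on `I` counting multiplicities does not exceed `k(n − k)`» (disconjugate on `I` =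
every nontrivial solution has at most `n − 1` zeros on `I` counting multiplicities; the case `k = 2`, `n = 4` is B. Shapiro,
M. Shapiro, Int. J. Math. 11 (2000)).  The span of `x^{d₀}, …, x^{d_{K−1}}` on `(0, ∞)` is the solution space of the Euler
equation `∏ₗ (x·d/dx − dₗ) y = 0`, DISCONJUGATE on `(0, ∞)` by Descartes' rule of signs with multiplicities (tree:
`BD17.satisfiesDescartesRule_rpow`), so the theorem gives `Z₊(W(u,v)) ≤ 2(K − 2)`.

* the NAMED FACT `Literature.Analysis.ODE.GrassmannConvexityTwo` (tree, `Literature/Analysis/ODE/GrassmannConvexity.lean`, relocated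
  from this file by the gate, p832086): the theorem typed in the tree's vocabulary (`BD17.linComb`, `BD17.wronskian`,
  `BD17.rootCountMult`) for an analytic fundamental system on an open interval (equation `W(f₁, …, fₙ, y) / W(f₁, …, fₙ) = 0`);
* `wronskian_monomials_ne_zero` — the Wronskian of `x^{d₀}, …, x^{d_{K−1}}` (distinct `dₗ`) does not vanish on `x ≠ 0`
  (`= x^{Σdₗ − K(K−1)/2} · ∏_{a<b} (d_b − d_a)`, via the Vandermonde determinant of the falling factorials);
* ★★ `conjectureW_of_grassmannConvexityTwo` — `GrassmannConvexityTwo → ConjectureW`; `conjectureWAt_of_grassmannConvexityTwo` (each `K`).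

HONEST FRAMING: a CONDITIONAL result (trust base: the cited theorem, whose 25-page proof is not formalised here); it identifies the
line's located target (W-4), and Conjecture W at every `K`, as known mathematics.  Nothing here bears on S4/S4f/S5/S5ᴸ, TowerB,
`WeakLifting`, Conjecture B, `MatrixDescartes` (18050) or `VP ≠ VNP`.  Seat: prover leafhand-val-kpluslogsqlaw-1 g13,
`--supports stmt-ValiantsHypothesis-19561`.
-/

-- `Summit.ValiantsHypothesis.ValiantsHypothesis.…` repeats a component by the D-0017 layout
-- (single-conjunct summit), which the `dupNamespace` linter flags; the name is mandated.
set_option linter.dupNamespace false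
set_option autoImplicit false

namespace Summit.ValiantsHypothesis.ValiantsHypothesis.Theorems.KPlusLogSqLaw.TowerGraft

open Polynomial Finset
open scoped BigOperators Polynomial
open Literature.Computability.AlgebraicComplexity
open Literature.Computability.AlgebraicComplexity.BD17 (linComb rootCountMult SatisfiesDescartesRule)

namespace WronskianDevelopable


/-! ## The Wronskian of a system of monomials -/

/-- `(xᵐ)⁽ⁱ⁾ = m(m−1)⋯(m−i+1)·x^{m−i}` with the falling factorial written as `descPochhammer`. [folklore] -/
theorem iteratedDeriv_pow_eq_descPochhammer (m i : ℕ) (x : ℝ) :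
    iteratedDeriv i (fun y : ℝ => y ^ m) x = (descPochhammer ℝ i).eval (m : ℝ) * x ^ (m - i) := by
  rw [iteratedDeriv_eq_iterate, iter_deriv_pow, descPochhammer_eval_eq_prod_range]

/-- the same entry, factored as `(xⁱ)⁻¹ · (P_i(m) · xᵐ)` for `x ≠ 0` (when `i > m` both sides vanish). [folklore] -/
theorem iteratedDeriv_pow_eq_factored (m i : ℕ) {x : ℝ} (hx : x ≠ 0) :
    iteratedDeriv i (fun y : ℝ => y ^ m) x = (x ^ i)⁻¹ * ((descPochhammer ℝ i).eval (m : ℝ) * x ^ m) := by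
  rw [iteratedDeriv_pow_eq_descPochhammer]
  by_cases h : i ≤ m
  · rw [pow_sub₀ _ hx h]
    ring
  · have h0 : (descPochhammer ℝ i).eval (m : ℝ) = 0 := by
      rw [descPochhammer_eval_eq_descFactorial ℝ m i]
      exact_mod_cast Nat.descFactorial_eq_zero_iff_lt.mpr (by omega)
    rw [h0]
    ring

/-- **the Wronskian of distinct monomials does not vanish off the origin**: for pairwise distinct `d₀, …, d_{K−1}` and `x ≠ 0`,
`W(x^{d₀}, …, x^{d_{K−1}})(x) ≠ 0` (it equals `x^{Σdₗ − K(K−1)/2}` times the Vandermonde determinant of `d`). [folklore] -/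
theorem wronskian_monomials_ne_zero {K : ℕ} (d : Fin K → ℕ) (hd : Function.Injective d) {x : ℝ} (hx : x ≠ 0) :
    BD17.wronskian (fun (l : Fin K) (y : ℝ) => y ^ d l) x ≠ 0 := by
  unfold BD17.wronskian
  have hentry : (Matrix.of fun i j : Fin K => iteratedDeriv i.val (fun y : ℝ => y ^ d j) x) =
      Matrix.of fun i j : Fin K => (x ^ (i : ℕ))⁻¹ *
        (Matrix.of (fun i j : Fin K => x ^ d j * (descPochhammer ℝ (i : ℕ)).eval ((d j : ℕ) : ℝ)) i j) := by
    ext i j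
    simp only [Matrix.of_apply]
    rw [iteratedDeriv_pow_eq_factored (d j) i hx]
    ring
  rw [hentry, Matrix.det_mul_column, Matrix.det_mul_row]
  have hV : (Matrix.of fun i j : Fin K => (descPochhammer ℝ (i : ℕ)).eval ((d j : ℕ) : ℝ)).det ≠ 0 := by
    have hT : (Matrix.of fun i j : Fin K => (descPochhammer ℝ (i : ℕ)).eval ((d j : ℕ) : ℝ)) =
        (Matrix.of fun i j : Fin K => (descPochhammer ℝ (j : ℕ)).eval ((d i : ℕ) : ℝ)).transpose := by
      ext i j; rfl
    rw [hT, Matrix.det_transpose,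
      ← Matrix.det_eval_matrixOfPolynomials_eq_det_vandermonde (fun i : Fin K => ((d i : ℕ) : ℝ))
        (fun j : Fin K => descPochhammer ℝ (j : ℕ)) (fun i => descPochhammer_natDegree ℝ i)
        (fun i => monic_descPochhammer ℝ i)]
    refine Matrix.det_vandermonde_ne_zero_iff.mpr ?_
    intro i j hij
    have hij' : ((d i : ℕ) : ℝ) = ((d j : ℕ) : ℝ) := by simpa using hij
    exact hd (by exact_mod_cast hij')
  refine mul_ne_zero (Finset.prod_ne_zero_iff.mpr fun i _ => inv_ne_zero (pow_ne_zero _ hx)) ?_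
  exact mul_ne_zero (Finset.prod_ne_zero_iff.mpr fun j _ => pow_ne_zero _ hx) hV

/-! ## The fewnomial span is disconjugate on `(0, ∞)` (Descartes with multiplicities) -/

/-- every nontrivial real `K`-nomial `Σ aₗ x^{dₗ}` (strictly increasing natural exponents) has finitely many zeros in `(0,∞)`,
at most `K − 1` counting multiplicities. [folklore: Descartes' rule of signs; tree `BD17.satisfiesDescartesRule_rpow`] -/
theorem fewnomial_disconjugate {K : ℕ} (d : Fin K → ℕ) (hd : StrictMono d) (a : Fin K → ℝ) (ha : a ≠ 0) :
    {x | x ∈ Set.Ioi (0 : ℝ) ∧ linComb a (fun (l : Fin K) (y : ℝ) => y ^ d l) x = 0}.Finite ∧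
      rootCountMult (linComb a (fun (l : Fin K) (y : ℝ) => y ^ d l)) (Set.Ioi 0) ≤ K - 1 := by
  have hmono : StrictMono (fun l : Fin K => ((d l : ℕ) : ℝ)) := fun i j hij => by
    show ((d i : ℕ) : ℝ) < ((d j : ℕ) : ℝ)
    exact_mod_cast hd hij
  have hD := BD17.satisfiesDescartesRule_rpow (fun l : Fin K => ((d l : ℕ) : ℝ)) hmono
  have hfun : (fun (l : Fin K) (y : ℝ) => y ^ (((d l : ℕ) : ℝ))) = fun (l : Fin K) (y : ℝ) => y ^ d l := by
    funext l y
    exact Real.rpow_natCast y (d l)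
  rw [hfun] at hD
  obtain ⟨hfin, hle⟩ := hD a ha
  refine ⟨hfin, hle.trans ?_⟩
  simpa [List.length_ofFn] using signVar_le_length_sub_one (List.ofFn a)

/-! ## From the fact to Conjecture W -/

/-- the fewnomial as a function is the evaluation of the polynomial `Σ C aₗ X^{dₗ}`. [folklore] -/
theorem linComb_monomials_eq_eval {K : ℕ} (d : Fin K → ℕ) (a : Fin K → ℝ) :
    linComb a (fun (l : Fin K) (y : ℝ) => y ^ d l) = fun y => (∑ l, C (a l) * (X : ℝ[X]) ^ d l).eval y := by
  funext y
  simp [linComb, eval_finsetSum]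

/-- the Wronskian function of two fewnomials is the evaluation of the polynomial Wronskian. [folklore] -/
theorem wronskianFun_eq_eval {K : ℕ} (d : Fin K → ℕ) (u v : Fin K → ℝ) :
    (fun x => linComb u (fun (l : Fin K) (y : ℝ) => y ^ d l) x * deriv (linComb v (fun (l : Fin K) (y : ℝ) => y ^ d l)) x -
        deriv (linComb u (fun (l : Fin K) (y : ℝ) => y ^ d l)) x * linComb v (fun (l : Fin K) (y : ℝ) => y ^ d l) x) =
      fun x => (wronskian (∑ l, C (u l) * (X : ℝ[X]) ^ d l) (∑ l, C (v l) * (X : ℝ[X]) ^ d l)).eval x := by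
  rw [linComb_monomials_eq_eval d u, linComb_monomials_eq_eval d v]
  funext x
  rw [Polynomial.deriv, Polynomial.deriv, wronskian, eval_sub, eval_mul, eval_mul]

/-- `W(c·p, q) = c·W(p, q)`. [folklore] -/
theorem wronskian_smul_left' (c : ℝ) (p q : ℝ[X]) : wronskian (c • p) q = c • wronskian p q := by
  simp only [wronskian, smul_eq_C_mul, derivative_mul, derivative_C, zero_mul, zero_add]
  ring

/-- `W(p, c·q) = c·W(p, q)`. [folklore] -/
theorem wronskian_smul_right' (c : ℝ) (p q : ℝ[X]) : wronskian p (c • q) = c • wronskian p q := by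
  simp only [wronskian, smul_eq_C_mul, derivative_mul, derivative_C, zero_mul, zero_add]
  ring

/-- if the polynomial Wronskian is nonzero, the coefficient vectors are linearly independent. [folklore] -/
theorem linearIndependent_pair_of_wronskian_ne_zero {K : ℕ} (d : Fin K → ℕ) (u v : Fin K → ℝ)
    (hW : wronskian (∑ l, C (u l) * (X : ℝ[X]) ^ d l) (∑ l, C (v l) * (X : ℝ[X]) ^ d l) ≠ 0) :
    LinearIndependent ℝ ![u, v] := by
  rw [LinearIndependent.pair_iff]
  intro s t hst
  set pu : ℝ[X] := ∑ l, C (u l) * (X : ℝ[X]) ^ d l with hpu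
  set pv : ℝ[X] := ∑ l, C (v l) * (X : ℝ[X]) ^ d l with hpv
  have hcomb : s • pu + t • pv = 0 := by
    have hl : ∀ l, s * u l + t * v l = 0 := fun l => by
      have := congrFun hst l
      simpa using this
    rw [hpu, hpv, Finset.smul_sum, Finset.smul_sum, ← Finset.sum_add_distrib]
    refine Finset.sum_eq_zero fun l _ => ?_
    rw [smul_eq_C_mul, smul_eq_C_mul, ← mul_assoc, ← mul_assoc, ← add_mul, ← C_mul, ← C_mul, ← C_add, hl l, C_0,
      zero_mul]
  by_contra hne
  have hsW : s • wronskian pu pv = 0 := by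
    have h1 : s • pu = -(t • pv) := eq_neg_of_add_eq_zero_left hcomb
    rw [← wronskian_smul_left', h1, ← neg_smul, wronskian_smul_left', wronskian_self_eq_zero, smul_zero]
  have htW : t • wronskian pu pv = 0 := by
    have h1 : t • pv = -(s • pu) := eq_neg_of_add_eq_zero_right hcomb
    rw [← wronskian_smul_right', h1, ← neg_smul, wronskian_smul_right', wronskian_self_eq_zero, smul_zero]
  rcases not_and_or.mp hne with hs | ht
  · exact hW (by simpa [hs] using hsW)
  · exact hW (by simpa [ht] using htW)

/-- ★★ **CONJECTURE W AT `K` LETTERS FROM THE GRASSMANN CONVEXITY THEOREM (`k = 2`).** [cite: SaldanhaShapiroShapiro2021, Theorem 1]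
(conditional on the named fact `GrassmannConvexityTwo`; the reduction is this work) -/
theorem conjectureWAt_of_grassmannConvexityTwo (hGC : Literature.Analysis.ODE.GrassmannConvexityTwo) (K : ℕ) : ConjectureWAt K := by
  classical
  by_cases hK : K ≤ 3
  · exact conjectureWAt_of_le_three hK
  intro u v d hd
  have hK3 : 3 ≤ K := by omega
  set pu : ℝ[X] := ∑ l, C (u l) * (X : ℝ[X]) ^ d l with hpu
  set pv : ℝ[X] := ∑ l, C (v l) * (X : ℝ[X]) ^ d l with hpv
  set W : ℝ[X] := wronskian pu pv with hWdef
  by_cases hW0 : W = 0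
  · rw [hW0, roots_zero]
    simp
  -- the fact, applied to the monomial system on `(0, ∞)`
  set f : Fin K → ℝ → ℝ := fun l y => y ^ d l with hf
  have hana : ∀ i, AnalyticOnNhd ℝ (f i) (Set.Ioi 0) := fun i => by
    have h := (analyticOnNhd_id (𝕜 := ℝ) (s := Set.Ioi (0 : ℝ))).pow (d i)
    exact h
  have hWr : ∀ x ∈ Set.Ioi (0 : ℝ), BD17.wronskian f x ≠ 0 := fun x hx =>
    wronskian_monomials_ne_zero d hd.injective (ne_of_gt hx)
  have hdisc : ∀ a : Fin K → ℝ, a ≠ 0 →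
      {x | x ∈ Set.Ioi (0 : ℝ) ∧ linComb a f x = 0}.Finite ∧ rootCountMult (linComb a f) (Set.Ioi 0) ≤ K - 1 :=
    fun a ha => fewnomial_disconjugate d hd a ha
  have hli : LinearIndependent ℝ ![u, v] := linearIndependent_pair_of_wronskian_ne_zero d u v hW0
  obtain ⟨hfin, hcount⟩ := hGC K hK3 (Set.Ioi 0) isOpen_Ioi isConnected_Ioi f hana hWr hdisc u v hli
  rw [wronskianFun_eq_eval d u v] at hcount
  have hset : {x | x ∈ Set.Ioi (0 : ℝ) ∧ linComb u f x * deriv (linComb v f) x - deriv (linComb u f) x * linComb v f x = 0} =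
      {x | x ∈ Set.Ioi (0 : ℝ) ∧ (fun x => W.eval x) x = 0} := by
    have h := wronskianFun_eq_eval d u v
    ext x
    simp only [Set.mem_setOf_eq]
    rw [show linComb u f x * deriv (linComb v f) x - deriv (linComb u f) x * linComb v f x =
      (fun x => linComb u f x * deriv (linComb v f) x - deriv (linComb u f) x * linComb v f x) x from rfl, h]
  rw [hset] at hfin
  -- count: distinct positive roots ≤ roots with multiplicity = `rootCountMult`
  have hle : (W.roots.toFinset.filter (fun x => 0 < x)).card ≤ rootCountMult (fun x => W.eval x) (Set.Ioi 0) := by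
    unfold rootCountMult
    rw [finsum_mem_eq_finite_toFinset_sum _ hfin]
    have hTS : W.roots.toFinset.filter (fun x => 0 < x) = hfin.toFinset := by
      ext x
      simp only [Finset.mem_filter, Multiset.mem_toFinset, Set.Finite.mem_toFinset, Set.mem_setOf_eq, Set.mem_Ioi,
        mem_roots hW0, IsRoot.def]
      tauto
    rw [hTS, Finset.card_eq_sum_ones]
    refine Finset.sum_le_sum fun x hx => ?_
    rw [BD17.analyticOrderNatAt_eval_realPoly hW0]
    have hx' : W.IsRoot x := by
      have := (Set.Finite.mem_toFinset hfin).mp hx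
      exact this.2
    exact Nat.one_le_iff_ne_zero.mpr ((rootMultiplicity_pos hW0).mpr hx').ne'
  calc (W.roots.toFinset.filter (fun x => 0 < x)).card ≤ rootCountMult (fun x => W.eval x) (Set.Ioi 0) := hle
    _ ≤ 2 * (K - 2) := hcount
    _ = 2 * K - 4 := by omega

/-- ★★ **CONJECTURE W (every `K`) FROM THE GRASSMANN CONVEXITY THEOREM for `k = 2`.** [cite: SaldanhaShapiroShapiro2021, Theorem 1]
(conditional on the named fact `GrassmannConvexityTwo`) -/
theorem conjectureW_of_grassmannConvexityTwo (hGC : Literature.Analysis.ODE.GrassmannConvexityTwo) : ConjectureW :=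
  fun K => conjectureWAt_of_grassmannConvexityTwo hGC K

end WronskianDevelopable

end Summit.ValiantsHypothesis.ValiantsHypothesis.Theorems.KPlusLogSqLaw.TowerGraft
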